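import Literature.Analysis.FluidPDE.TaoClassGlue
import Literature.Analysis.FluidPDE.AxisymmetricEuler
import HarnessLib

/-!
# Named fact: Ladyzhenskaya's weighted enstrophy bound `∫ |ω|² r⁻² ≤ ‖ω₀‖²_{Ḣ¹}`

Analysis/FluidPDE facts file (D-0014 named fact, nothing asserted): the first of the two
analytic inputs in the decomposition of the a-priori bound
`Literature.Analysis.FluidPDE.axisymmetricNoSwirl_enstrophy_apriori`
(`AxisymmetricNoSwirlApriori.lean`), itself the analytic leaf of
`Literature.Analysis.FluidPDE.axisymmetric_no_swirl_global_regularity` (`Axisymmetric.lean`,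
reduction in `AxisymmetricNoSwirlGlobal.lean`). Held source:

* P. G. Lemarié-Rieusset, *The Navier–Stokes Problem in the 21st Century*, CRC Press (2016),
  §10.3, proof of Theorem 10.4, pp. 286–288: "Ladyzhenskaya's key observation is that we have a
  uniform control of `∫ |ω|² r⁻² dx`" — identity (10.25), the regularised weights
  `r^η α_ε(r) r⁻²` of Leonardi–Málek–Nečas–Pokorný ((10.26)), and the conclusion
  **(10.27)** `∫ |ω(t)|² r⁻² dx ≤ ‖ω₀‖²_{Ḣ¹} + ν⁻¹ ∫₀ᵗ ‖f‖²_{Ḣ¹} ds` (p. 288).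

## The statement and its rendering

In print, `u` is the `H²` solution of Thm. 7.3 (locally `L^∞_t H² ∩ L²_t H³`), axisymmetric
without swirl, `ω = curl u = ω_θ e_θ`, `r = √(x₀² + x₁²)`, and (10.27) holds for every `t`
before the maximal time. Here: the unforced case `f = 0`, for the smooth sub-class
`IsTaoSolutionOn T ν u₀ u p` (`TaoClassGlue.lean`: classical solution on `[0, T] × ℝ³` with
`u, ∂ₜu, p ∈ L^∞_t H^k_x` for all `k`, `u ∈ C([0, T]; L²)`; Tao 2013, Thm. 5.4) which is
axisymmetric without swirl at all times of `[0, T]` (accepted `IsAxisymmetric`, `HasNoSwirl`;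
their propagation from the datum is proved in `AxisymmetricNoSwirlGlobal.lean`, so assuming them
only weakens the fact). The weighted enstrophy is the lower Lebesgue integral of
`|ω(t, x)|² / r(x)²` over the complement of the axis `{r ≠ 0}` (the axis is Lebesgue-null, so
this is the printed `∫ |ω|² r⁻² dx`; restricting the domain avoids the junk value of `·/0`),
with `ω = curl (u t)` the accepted `Literature.Analysis.FluidPDE.curl` and `r = cylRadius`;
`‖ω₀‖²_{Ḣ¹} = ∫ |∇ ⊗ ω₀|²` is `∫⁻ ofReal (frobeniusNormSq (fderiv ℝ (curl u₀) x))` (Frobenius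
norm, the book's `|∇ ⊗ ·|`). Both sides may a priori be compared in `[0, ∞]`; for the smooth
class the right side is finite (`u₀ ∈ H²`) and so is the left (pointwise
`ω_θ² r⁻² ≤ |∇ ⊗ ω|²`, p. 286).

Nothing is asserted; users take `(h : axisymmetricNoSwirl_weightedEnstrophy_le)`.

## Mathlib / tree search

`lean search 'weightedEnstrophy|cylRadius.*curl|omegaTilde'`: the tree has the Euler-case
transport equation of `ω̃ = ω_θ / r` off the axis
(`IsClassicalNSSolutionOn.chenHou_omegaTilde_transport`, `AxisymmetricVorticityTransport.lean`)
and the viscous transport equation of `Ω = r ω_θ` (`swirl_vorticity_transport`), the raw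
material of Ukhovskii–Yudovich's proof of this bound (`η = ω_θ/r` solves
`∂ₜη + u·∇η = ν(Δ + 2r⁻¹∂ᵣ)η`, whose `L²` norm does not increase); no weighted enstrophy
estimate. Mathlib has no Navier–Stokes theory.

## References

* P. G. Lemarié-Rieusset, *The Navier–Stokes Problem in the 21st Century*, CRC Press 2016,
  Thm. 10.4, proof, pp. 286–288, (10.25)–(10.27). [LemarieRieusset2016]
* O. A. Ladyzhenskaya, Zap. Naučn. Sem. LOMI 7 (1968), 155–177 (the book's [295]).
* M. R. Ukhovskii, V. I. Yudovich, J. Appl. Math. Mech. 32 (1968), 52–69 (the book's [486]).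
* S. Leonardi, J. Málek, J. Nečas, M. Pokorný, Z. Anal. Anwendungen 18 (1999), 639–649
  (the book's [326]).
-/

noncomputable section

open MeasureTheory Set
open scoped ENNReal

namespace Literature.Analysis.FluidPDE

/-- Local notation for physical space `ℝ³ = EuclideanSpace ℝ (Fin 3)`. -/
local notation "ℝ³" => EuclideanSpace ℝ (Fin 3)

/-- **Ladyzhenskaya's weighted enstrophy bound for axisymmetric flows without swirl**
(Lemarié-Rieusset 2016, proof of Thm. 10.4, (10.27), p. 288, after Ladyzhenskaya 1968,
Ukhovskii–Yudovich 1968 and, for the proof, Leonardi–Málek–Nečas–Pokorný 1999). In print: for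
the regular solution `u` of Navier–Stokes (`ν > 0`) which is axisymmetric without swirl,
`ω = curl u`, one has for every `t`
`∫ |ω(t)|² r⁻² dx ≤ ‖ω₀‖²_{Ḣ¹} + ν⁻¹ ∫₀ᵗ ‖f‖²_{Ḣ¹} ds`.
Rendered with `f = 0`, for the tree's smooth continuation class (a sub-class of the book's):
for `ν > 0`, `T > 0` and every Tao-class solution `(u, p)` on `[0, T] × ℝ³` from `u₀`
(`IsTaoSolutionOn T ν u₀ u p`) which is axisymmetric without swirl at all times of `[0, T]`,
and every `t ∈ [0, T]`:
`∫_{r ≠ 0} |curl u(t, x)|² / r(x)² dx ≤ ∫ |∇ ⊗ curl u₀(x)|² dx` (lower Lebesgue integrals; the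
axis `{r = 0}` is null; Frobenius norm of the gradient). Users take
`(h : axisymmetricNoSwirl_weightedEnstrophy_le)`. [cite: LemarieRieusset2016, Thm. 10.4, proof: (10.27), p. 288 (with (10.25)–(10.26), pp. 286–287)] -/
def axisymmetricNoSwirl_weightedEnstrophy_le : Prop :=
  ∀ ⦃ν T : ℝ⦄, 0 < ν → 0 < T →
    ∀ ⦃u₀ : ℝ³ → ℝ³⦄ ⦃u : ℝ → ℝ³ → ℝ³⦄ ⦃p : ℝ → ℝ³ → ℝ⦄, IsTaoSolutionOn T ν u₀ u p →
      (∀ t ∈ Icc 0 T, IsAxisymmetric (u t)) → (∀ t ∈ Icc 0 T, HasNoSwirl (u t)) →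
      ∀ t ∈ Icc 0 T,
        ∫⁻ x in {x | cylRadius x ≠ 0}, ENNReal.ofReal (‖curl (u t) x‖ ^ 2 / cylRadius x ^ 2) ≤
          ∫⁻ x, ENNReal.ofReal (frobeniusNormSq (fderiv ℝ (curl u₀) x))

end Literature.Analysis.FluidPDE

end
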